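import Mathlib
import Literature.AlgebraicGeometry.Resolution.AdicCompletionRegular
import Literature.AlgebraicGeometry.Resolution.ArtinApproximationAffineLemmas
import Literature.AlgebraicGeometry.Resolution.RegularSystemOfParameters
import HarnessLib

/-!
# The formal axis of an infinite chain of near points

Topic: `Literature/AlgebraicGeometry/Resolution`. Completion step of the "standard arguments" in
the termination proof of Cossart–Piltant 2008, Prop. 4.4 (p. 11: "there exists a regular
(possibly formal) curve `Γ` such that `x_{σ(i)}` belongs to the strict transform of `Γ` for
`i ≥ i₁` […] `Γ ⊆ Σ(i₁)`"): let `(R, 𝔪)` be a regular local ring of dimension `3` with regular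
system of parameters `(u, y₂, y₃)`, and let `z₂⁽ᴺ⁾, z₃⁽ᴺ⁾ ∈ R` be corrected parameters with
`z⁽⁰⁾ = y`, `z⁽ᴺ⁺¹⁾ − z⁽ᴺ⁾ ∈ 𝔪^{N+2}` (the depth-`N` adapted coordinates along the chain) such that
`J ⊆ (z₂⁽ᴺ⁾, z₃⁽ᴺ⁾)^μ + (u^{N+1})` for all `N` (`WeightedOrderChainLaw.le_pow_span_sup_of_nearChain`).
Then the limits `ŷᵢ = lim z_i⁽ᴺ⁾` in the completion `R^` exist, `(u, ŷ₂, ŷ₃)` is a regular system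
of parameters of `R^`, the **formal axis** `𝔓 = (ŷ₂, ŷ₃)` is a non-maximal prime of `R^`, and
**`J R^ ⊆ 𝔓^μ`** (`exists_prime_ne_maximalIdeal_map_le_pow`), ready for
`OrderAlongFormalBranch.map_le_pow_maximalIdeal_localization_under`.

* `adicLimit` — the limit of a sequence with `z⁽ⁿ⁺¹⁾ − z⁽ⁿ⁾ ∈ 𝔪ⁿ`, `adicLimit_sub_of_mem` —
  `ŷ − z⁽ⁿ⁾ ∈ 𝔪ⁿR^`;
* `sup_pow_le_pow_sup` — `(P + M)^μ ⊆ P^μ + M`; `le_of_forall_le_sup_pow` — Krull: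
  `(∀ n, I ≤ P + 𝔪ⁿ) → I ≤ P` in a Noetherian local ring;
* `exists_prime_ne_maximalIdeal_map_le_pow` — the theorem.

## Sources

* V. Cossart, O. Piltant, J. Algebra 320 (2008), proof of Prop. 4.4, p. 11. [CossartPiltant2008]
* H. Matsumura, *Commutative Ring Theory* (1986), §8 (completion), Thm. 8.10 (Krull). [Matsumura1987]
-/

noncomputable section

open IsLocalRing

namespace Literature.AlgebraicGeometry.Resolution

universe u

/-! ## Two ideal-theoretic lemmas -/

/-- `(P + M)^μ ⊆ P^μ + M`. [folklore] -/
theorem sup_pow_le_pow_sup {S : Type*} [CommRing S] (P M : Ideal S) (μ : ℕ) :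
    (P ⊔ M) ^ μ ≤ P ^ μ ⊔ M := by
  induction μ with
  | zero => simp
  | succ μ ih =>
    rw [pow_succ, pow_succ]
    calc (P ⊔ M) ^ μ * (P ⊔ M) ≤ (P ^ μ ⊔ M) * (P ⊔ M) := Ideal.mul_mono_left ih
      _ ≤ P ^ μ * P ⊔ M := by
        rw [Ideal.sup_mul, Ideal.mul_sup, Ideal.mul_sup]
        refine sup_le (sup_le le_sup_left ?_) (sup_le ?_ ?_)
        · exact Ideal.mul_le_left.trans le_sup_right
        · exact Ideal.mul_le_right.trans le_sup_right
        · exact Ideal.mul_le_right.trans le_sup_right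

/-- **Krull**: in a Noetherian local ring, `I ≤ P + 𝔪ⁿ` for all `n` forces `I ≤ P`.
[cite: Matsumura1987, Thm. 8.10] -/
theorem le_of_forall_le_sup_pow {S : Type*} [CommRing S] [IsLocalRing S] [IsNoetherianRing S]
    {I P : Ideal S} (h : ∀ n, I ≤ P ⊔ maximalIdeal S ^ n) : I ≤ P := by
  intro x hx
  by_cases hP : P = ⊤
  · rw [hP]; exact Submodule.mem_top
  haveI : Nontrivial (S ⧸ P) := Ideal.Quotient.nontrivial_iff.mpr hP
  haveI : IsLocalRing (S ⧸ P) :=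
    IsLocalRing.of_surjective' (Ideal.Quotient.mk P) Ideal.Quotient.mk_surjective
  have hk := Ideal.iInf_pow_eq_bot_of_isLocalRing (maximalIdeal (S ⧸ P))
    (maximalIdeal.isMaximal _).ne_top
  have hmem : Ideal.Quotient.mk P x ∈ ⨅ n : ℕ, maximalIdeal (S ⧸ P) ^ n := by
    rw [Ideal.mem_iInf]
    intro n
    obtain ⟨p, hp, m, hm, hpm⟩ := Submodule.mem_sup.mp (h n hx)
    rw [← hpm, map_add, Ideal.Quotient.eq_zero_iff_mem.mpr hp, zero_add,
      ← IsLocalRing.map_maximalIdeal_of_surjective _ Ideal.Quotient.mk_surjective, ← Ideal.map_pow]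
    exact Ideal.mem_map_of_mem _ hm
  rw [hk, Ideal.mem_bot] at hmem
  exact Ideal.Quotient.eq_zero_iff_mem.mp hmem

/-! ## Limits in the completion -/

section Limit

variable {R : Type u} [CommRing R] [IsLocalRing R] [IsNoetherianRing R]

local notation "R^" => AdicCompletion (maximalIdeal R) R

/-- **The `𝔪`-adic limit** of a sequence `z` with `z⁽ⁿ⁺¹⁾ − z⁽ⁿ⁾ ∈ 𝔪ⁿ`. [folklore] -/
def adicLimit (z : ℕ → R) (hz : ∀ n, z (n + 1) - z n ∈ maximalIdeal R ^ n) : R^ :=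
  AdicCompletion.mk (maximalIdeal R) R
    (AdicCompletion.AdicCauchySequence.mk (maximalIdeal R) R z fun n =>
      SModEq.sub_mem.mpr (by
        have : (maximalIdeal R ^ n • ⊤ : Submodule R R) = (maximalIdeal R ^ n : Ideal R) := by
          simp [Ideal.mul_top]
        rw [this, ← neg_sub]
        exact (Ideal.neg_mem_iff _).mpr (hz n)))

/-- `ŷ − z⁽ⁿ⁾ ∈ 𝔪ⁿ R^`. [folklore] -/
theorem adicLimit_sub_of_mem (z : ℕ → R) (hz : ∀ n, z (n + 1) - z n ∈ maximalIdeal R ^ n)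
    (n : ℕ) :
    adicLimit z hz - algebraMap R R^ (z n) ∈
      ((maximalIdeal R).map (algebraMap R R^)) ^ n := by
  refine AdicCompletion.sub_of_mem_pow_map_of_evalₐ_eq (maximalIdeal R)
    (maximalIdeal R).fg_of_isNoetherianRing _ _ ?_
  rw [adicLimit, AdicCompletion.evalₐ_mk]
  rfl

/-- `ŷ − z⁽ⁿ⁾ ∈ 𝔪̂ⁿ`. [folklore] -/
theorem adicLimit_sub_of_mem_pow (z : ℕ → R) (hz : ∀ n, z (n + 1) - z n ∈ maximalIdeal R ^ n)
    (n : ℕ) :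
    adicLimit z hz - algebraMap R R^ (z n) ∈ maximalIdeal R^ ^ n := by
  rw [AdicCompletion.maximalIdeal_eq_map]
  exact adicLimit_sub_of_mem z hz n

end Limit

/-! ## The formal axis -/

section Axis

variable {R : Type u} [CommRing R] [IsRegularLocalRing R]

local notation "R^" => AdicCompletion (maximalIdeal R) R

/-- **The formal axis of an infinite chain of near points** (Cossart–Piltant's formal curve `Γ`
with `Γ ⊆ Σ`): for corrected parameters `z⁽ᴺ⁾ → ŷ` as above with
`J ⊆ (z₂⁽ᴺ⁾, z₃⁽ᴺ⁾)^μ + (u^{N+1})` for all `N`, the ideal `𝔓 = (ŷ₂, ŷ₃)` of `R^` is a prime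
different from `𝔪̂` with `J R^ ⊆ 𝔓^μ`. [cite: CossartPiltant2008, proof of Prop. 4.4, p. 11] -/
theorem exists_prime_ne_maximalIdeal_map_le_pow (u y₂ y₃ : R)
    (hgen : Ideal.span {u, y₂, y₃} = maximalIdeal R) (hdim : ringKrullDim R = 3)
    (z₂ z₃ : ℕ → R) (hz₂ : ∀ n, z₂ (n + 1) - z₂ n ∈ maximalIdeal R ^ (n + 2))
    (hz₃ : ∀ n, z₃ (n + 1) - z₃ n ∈ maximalIdeal R ^ (n + 2)) (h0₂ : z₂ 0 = y₂) (h0₃ : z₃ 0 = y₃)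
    (J : Ideal R) (μ : ℕ)
    (hJ : ∀ N, J ≤ Ideal.span {z₂ N, z₃ N} ^ μ ⊔ Ideal.span {u ^ (N + 1)}) :
    ∃ 𝔓 : Ideal R^, 𝔓.IsPrime ∧ 𝔓 ≠ maximalIdeal R^ ∧ J.map (algebraMap R R^) ≤ 𝔓 ^ μ := by
  classical
  have hz₂' : ∀ n, z₂ (n + 1) - z₂ n ∈ maximalIdeal R ^ n := fun n =>
    Ideal.pow_le_pow_right (by omega) (hz₂ n)
  have hz₃' : ∀ n, z₃ (n + 1) - z₃ n ∈ maximalIdeal R ^ n := fun n =>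
    Ideal.pow_le_pow_right (by omega) (hz₃ n)
  set ŷ₂ : R^ := adicLimit z₂ hz₂' with hŷ₂
  set ŷ₃ : R^ := adicLimit z₃ hz₃' with hŷ₃
  set ι := algebraMap R R^ with hι
  set 𝔓 : Ideal R^ := Ideal.span {ŷ₂, ŷ₃} with h𝔓
  haveI : IsRegularLocalRing R^ := isRegularLocalRing_adicCompletion R
  have hdim' : ringKrullDim R^ = 3 := by rw [ringKrullDim_adicCompletion, hdim]
  have hmmap : maximalIdeal R^ = (maximalIdeal R).map ι := AdicCompletion.maximalIdeal_eq_map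
  -- (a) `J R^ ⊆ 𝔓^μ + 𝔪̂ⁿ` for all `n`, hence `J R^ ⊆ 𝔓^μ`
  have hJle : J.map ι ≤ 𝔓 ^ μ := by
    refine le_of_forall_le_sup_pow fun n => ?_
    have hzmem : ∀ (z : ℕ → R) (hz : ∀ n, z (n + 1) - z n ∈ maximalIdeal R ^ n) (ŷ : R^),
        ŷ = adicLimit z hz → ŷ ∈ 𝔓 → ι (z n) ∈ 𝔓 ⊔ maximalIdeal R^ ^ n := by
      intro z hz ŷ hŷ hŷP
      have hsub := adicLimit_sub_of_mem_pow z hz n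
      rw [← hŷ] at hsub
      have : ι (z n) = ŷ - (ŷ - ι (z n)) := by ring
      rw [this]
      exact Ideal.sub_mem _ (Ideal.mem_sup_left hŷP) (Ideal.mem_sup_right hsub)
    have h2 : ι (z₂ n) ∈ 𝔓 ⊔ maximalIdeal R^ ^ n :=
      hzmem z₂ hz₂' ŷ₂ hŷ₂ (Ideal.subset_span (by simp))
    have h3 : ι (z₃ n) ∈ 𝔓 ⊔ maximalIdeal R^ ^ n :=
      hzmem z₃ hz₃' ŷ₃ hŷ₃ (Ideal.subset_span (by simp))
    have hspan : (Ideal.span {z₂ n, z₃ n}).map ι ≤ 𝔓 ⊔ maximalIdeal R^ ^ n := by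
      rw [Ideal.map_span, Ideal.span_le]
      rintro _ ⟨a, ha, rfl⟩
      simp only [Set.mem_insert_iff, Set.mem_singleton_iff] at ha
      rcases ha with rfl | rfl
      · exact h2
      · exact h3
    have hu : ι (u ^ (n + 1)) ∈ maximalIdeal R^ ^ n := by
      rw [map_pow]
      refine Ideal.pow_le_pow_right (Nat.le_succ n) (Ideal.pow_mem_pow ?_ (n + 1))
      rw [hmmap]
      exact Ideal.mem_map_of_mem _ (hgen ▸ Ideal.subset_span (by simp))
    calc J.map ι ≤ (Ideal.span {z₂ n, z₃ n} ^ μ ⊔ Ideal.span {u ^ (n + 1)}).map ι :=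
          Ideal.map_mono (hJ n)
      _ = (Ideal.span {z₂ n, z₃ n}).map ι ^ μ ⊔ (Ideal.span {u ^ (n + 1)}).map ι := by
          rw [Ideal.map_sup, Ideal.map_pow]
      _ ≤ (𝔓 ⊔ maximalIdeal R^ ^ n) ^ μ ⊔ maximalIdeal R^ ^ n := by
          refine sup_le_sup (Ideal.pow_right_mono hspan μ) ?_
          rw [Ideal.map_span, Set.image_singleton, Ideal.span_le, Set.singleton_subset_iff]
          exact hu
      _ ≤ 𝔓 ^ μ ⊔ maximalIdeal R^ ^ n :=
          sup_le (sup_pow_le_pow_sup _ _ μ) le_sup_right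
  -- (b) `(u, ŷ₂, ŷ₃)` is a regular system of parameters of `R^`
  have hy₂m : y₂ ∈ maximalIdeal R := hgen ▸ Ideal.subset_span (by simp)
  have hy₃m : y₃ ∈ maximalIdeal R := hgen ▸ Ideal.subset_span (by simp)
  have hum : u ∈ maximalIdeal R := hgen ▸ Ideal.subset_span (by simp)
  -- `z⁽¹⁾ ∈ 𝔪`, `z⁽²⁾ − y ∈ 𝔪²`
  have hz1 : ∀ (z : ℕ → R), (∀ n, z (n + 1) - z n ∈ maximalIdeal R ^ (n + 2)) → ∀ y ∈ maximalIdeal R,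
      z 0 = y → z 1 ∈ maximalIdeal R ∧ z 2 - y ∈ maximalIdeal R ^ 2 := by
    intro z hz y hy h0
    have h01 : z 1 - z 0 ∈ maximalIdeal R ^ 2 := hz 0
    have h12 : z 2 - z 1 ∈ maximalIdeal R ^ 3 := hz 1
    constructor
    · have : z 1 = (z 1 - z 0) + y := by rw [h0]; ring
      rw [this]
      exact Ideal.add_mem _ (Ideal.pow_le_self (by norm_num) h01) hy
    · have : z 2 - y = (z 2 - z 1) + (z 1 - z 0) := by rw [h0]; ring
      rw [this]
      exact Ideal.add_mem _ (Ideal.pow_le_pow_right (by norm_num) h12) h01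
  obtain ⟨hz₂1, hz₂2⟩ := hz1 z₂ hz₂ y₂ hy₂m h0₂
  obtain ⟨hz₃1, hz₃2⟩ := hz1 z₃ hz₃ y₃ hy₃m h0₃
  have hŷmem : ∀ (z : ℕ → R) (hz : ∀ n, z (n + 1) - z n ∈ maximalIdeal R ^ n),
      z 1 ∈ maximalIdeal R → adicLimit z hz ∈ maximalIdeal R^ := by
    intro z hz h1
    have hsub := adicLimit_sub_of_mem_pow z hz 1
    rw [pow_one] at hsub
    have : adicLimit z hz = (adicLimit z hz - ι (z 1)) + ι (z 1) := by ring
    rw [this]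
    refine Ideal.add_mem _ hsub ?_
    rw [hmmap]; exact Ideal.mem_map_of_mem _ h1
  have hιy : ∀ (z : ℕ → R) (hz : ∀ n, z (n + 1) - z n ∈ maximalIdeal R ^ n) (y : R),
      z 2 - y ∈ maximalIdeal R ^ 2 →
      ι y ∈ Ideal.span {adicLimit z hz} ⊔ maximalIdeal R^ ^ 2 := by
    intro z hz y h2
    have hsub := adicLimit_sub_of_mem_pow z hz 2
    have : ι y = adicLimit z hz - (adicLimit z hz - ι (z 2)) - ι (z 2 - y) := by
      rw [map_sub]; ring
    rw [this]
    refine Ideal.sub_mem _ (Ideal.sub_mem _ (Ideal.mem_sup_left (Ideal.subset_span rfl))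
      (Ideal.mem_sup_right hsub)) (Ideal.mem_sup_right ?_)
    rw [hmmap, ← Ideal.map_pow]
    exact Ideal.mem_map_of_mem _ h2
  set x : Fin 3 → R^ := ![ι u, ŷ₂, ŷ₃] with hx
  have hxspan : Ideal.span (Set.range x) = maximalIdeal R^ := by
    have hrange : Set.range x = {ι u, ŷ₂, ŷ₃} := by
      rw [hx]; ext a
      simp [Matrix.range_cons, Matrix.range_empty]
      tauto
    rw [hrange]
    apply le_antisymm
    · rw [Ideal.span_le]
      intro a ha
      simp only [Set.mem_insert_iff, Set.mem_singleton_iff] at ha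
      rcases ha with rfl | rfl | rfl
      · rw [hmmap]; exact Ideal.mem_map_of_mem _ hum
      · exact hŷmem z₂ hz₂' hz₂1
      · exact hŷmem z₃ hz₃' hz₃1
    · -- Nakayama: `𝔪̂ ≤ (u, ŷ₂, ŷ₃) + 𝔪̂²`
      refine Submodule.le_of_le_smul_of_le_jacobson_bot (maximalIdeal R^).fg_of_isNoetherianRing
        (IsLocalRing.maximalIdeal_le_jacobson _) ?_
      rw [Ideal.smul_eq_mul, ← sq]
      have hmspan : Ideal.span (ι '' {u, y₂, y₃}) = (maximalIdeal R).map ι := by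
        rw [← Ideal.map_span, hgen]
      conv_lhs => rw [hmmap, ← hmspan]
      rw [Ideal.span_le]
      rintro _ ⟨a, ha, rfl⟩
      simp only [Set.mem_insert_iff, Set.mem_singleton_iff] at ha
      have hle₂ : Ideal.span {ŷ₂} ⊔ maximalIdeal R^ ^ 2 ≤
          Ideal.span {ι u, ŷ₂, ŷ₃} ⊔ maximalIdeal R^ ^ 2 :=
        sup_le_sup_right (Ideal.span_mono (Set.singleton_subset_iff.mpr (by simp))) _
      have hle₃ : Ideal.span {ŷ₃} ⊔ maximalIdeal R^ ^ 2 ≤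
          Ideal.span {ι u, ŷ₂, ŷ₃} ⊔ maximalIdeal R^ ^ 2 :=
        sup_le_sup_right (Ideal.span_mono (Set.singleton_subset_iff.mpr (by simp))) _
      rcases ha with rfl | rfl | rfl
      · exact Ideal.mem_sup_left (Ideal.subset_span (by simp))
      · exact hle₂ (hιy z₂ hz₂' _ hz₂2)
      · exact hle₃ (hιy z₃ hz₃' _ hz₃2)
  have hfr : (maximalIdeal R^).spanFinrank = 3 := by
    have := (isRegularLocalRing_iff R^).mp inferInstance
    rw [hdim'] at this
    exact_mod_cast this
  -- `𝔓 = (x₁, x₂)` is prime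
  have h𝔓eq : 𝔓 = Ideal.span (x '' ↑({1, 2} : Finset (Fin 3))) := by
    rw [h𝔓]; congr 1
    ext a
    simp [hx]
    tauto
  have hprime : 𝔓.IsPrime := by
    rw [h𝔓eq]; exact isPrime_span_image hfr x hxspan {1, 2}
  -- `𝔓 ≠ 𝔪̂`: `𝔪̂` needs three generators
  have hne : 𝔓 ≠ maximalIdeal R^ := by
    intro heq
    have h1 := Submodule.spanFinrank_span_le_ncard_of_finite (R := R^)
      (Set.toFinite ({ŷ₂, ŷ₃} : Set R^))
    have h2 : ({ŷ₂, ŷ₃} : Set R^).ncard ≤ 2 := by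
      rw [← Finset.coe_pair, Set.ncard_coe_finset]; exact Finset.card_le_two
    have h3 : (Ideal.span {ŷ₂, ŷ₃} : Ideal R^).spanFinrank = 3 := by
      change 𝔓.spanFinrank = 3
      rw [heq]; exact hfr
    change (Ideal.span {ŷ₂, ŷ₃}).spanFinrank ≤ _ at h1
    omega
  exact ⟨𝔓, hprime, hne, hJle⟩

end Axis

end Literature.AlgebraicGeometry.Resolution

end
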